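import Literature.Geometry.Riemannian.PinchingEstimatesLargestCore
import Literature.Geometry.Riemannian.PinchingEstimatesTwoLargest
import HarnessLib

/-!
# Hamilton 1997, Thm. 1.7 at the level of the curvature ODE — proved
(topic `Geometry/Riemannian`)

Part of the decomposition of `Literature.Geometry.Riemannian.hamilton_chenZhu_pinching`
(`PinchingEstimates.lean`). Hamilton 1997, §2.1, Thm. 1.7 (pp. 10–11): under
`max(a₃, b₃, c₃) ≤ Ξ(a₁ + a₂)`, `≤ Ξ(c₁ + c₂)` and `Ψ ≥ 4Ξ² + 1`, "the estimates `a₃ ≤ Ψ(a₁ + ρ)`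
and `c₃ ≤ Ψ(c₁ + ρ)` are preserved by the Ricci flow." PROVED here at the ODE level, in the
shape of the Thm. 1.7 hypothesis of `hamilton_chenZhu_pinching_of_ode₈`
(`PinchingEstimatesReduction.lean`):

* `isInvariantRel_largest_fst` / `_snd`, `hamilton1997_B17_ode` — relative to
  `{A, C symmetric} ∩ {a₁ + a₂ ≥ m} ∩ {c₁ + c₂ ≥ m} ∩ MaxLEPairSum Ξ ∩ {a₁ + ρ ≥ 0} ∩ {c₁ + ρ ≥ 0}`
  (`m, Ξ > 0`), the sets `{a₃ ≤ Ψ(a₁ + ρ)}`, `{c₃ ≤ Ψ(c₁ + ρ)}` are forward invariant under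
  Hamilton's ODE (the constraints `a₁ + ρ ≥ 0`, `c₁ + ρ ≥ 0` are not even needed).

Proof: barrier lemma `minOverSet_nonneg_of_deriv` (`HamiltonODEMinBarrier.lean`) for
`G = Ψ(wᵀAw + ρ) - uᵀAu` over `unitSet × unitSet` with `C = 0`, the derivative being
non-negative at minimisers by `largest_deriv_nonneg` (`PinchingEstimatesLargestCore.lean`).

## References

* R. S. Hamilton, Comm. Anal. Geom. 5 (1997), §2.1, Thm. 1.7 and its proof (pp. 10–11). [Hamilton1997]
* R. S. Hamilton, J. Differential Geom. 24 (1986), §3 (Lemmas 3.1, 3.5). [Hamilton1986]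
-/

noncomputable section

open Set Real Filter
open scoped Matrix BigOperators Topology

namespace Literature.Geometry.Riemannian

namespace HamiltonODE

/-- The parameter space `unitSet × unitSet`. [folklore] -/
abbrev UU : Type := (Fin 3 → ℝ) × (Fin 3 → ℝ)

/-- Derivative of `G_{Ψ,ρ}` along a matrix curve (the constant `ρ` drops out). [folklore] -/
theorem hasDerivAt_largestG (Ψ ρ : ℝ) {A : ℝ → Matrix (Fin 3) (Fin 3) ℝ}
    {A' : Matrix (Fin 3) (Fin 3) ℝ} {s : ℝ} (hA : ∀ k l, _root_.HasDerivAt (fun t ↦ A t k l) (A' k l) s)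
    (p : UU) : _root_.HasDerivAt (fun t ↦ largestG Ψ ρ (A t) p) (largestG Ψ 0 A' p) s := by
  have h := (((hasDerivAt_quadForm hA p.2 p.2).add_const ρ).const_mul Ψ).sub
    (hasDerivAt_quadForm hA p.1 p.1)
  simp only [largestG, add_zero]
  exact h

/-- `(M, p) ↦ G_{Ψ,ρ}(M, p)` is continuous. [folklore] -/
theorem continuous_largestG (Ψ ρ : ℝ) :
    Continuous fun z : Matrix (Fin 3) (Fin 3) ℝ × UU ↦ largestG Ψ ρ z.1 z.2 := by
  unfold largestG
  have h := continuous_quadForm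
  exact (continuous_const.mul ((h.comp (continuous_fst.prodMk
    ((continuous_snd.comp continuous_snd).prodMk (continuous_snd.comp continuous_snd)))).add
    continuous_const)).sub
    (h.comp (continuous_fst.prodMk
    ((continuous_fst.comp continuous_snd).prodMk (continuous_fst.comp continuous_snd))))

attribute [local irreducible] largestG in
/-- Joint continuity of `G_{Ψ,ρ}` along a continuous matrix curve. [folklore] -/
theorem continuousOn_largestG (Ψ ρ : ℝ) {A : ℝ → Matrix (Fin 3) (Fin 3) ℝ} {S : Set ℝ}
    (hA : ContinuousOn A S) (K : Set UU) :
    ContinuousOn (fun z : ℝ × UU ↦ largestG Ψ ρ (A z.1) z.2) (S ×ˢ K) := by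
  have h1 : ContinuousOn (fun z : ℝ × UU ↦ A z.1) (S ×ˢ K) :=
    hA.comp continuousOn_fst fun z hz ↦ (Set.mem_prod.1 hz).1
  have h2 : ContinuousOn (fun z : ℝ × UU ↦ (A z.1, z.2)) (S ×ˢ K) := h1.prodMk continuousOn_snd
  exact (continuous_largestG Ψ ρ).continuousOn.comp h2 (Set.mapsTo_univ _ _)

/-- **The sign condition at a minimiser of `G_{Ψ,ρ}`** (pointwise): `G' ≥ 0`.
[cite: Hamilton1997, §2.1, Thm. 1.7 (proof, p. 11)] -/
theorem largest_sign (Ψ ρ : ℝ) {M N : Matrix (Fin 3) (Fin 3) ℝ} {m Ξ : ℝ} (hm : 0 < m) (hΞ : 0 < Ξ)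
    (hΨ : 4 * Ξ ^ 2 + 1 ≤ Ψ) (hM : M.IsSymm) (h12 : M.TwoSmallestEigenvaluesSumGE m)
    (hA3 : ∀ u' z z' : Fin 3 → ℝ, u' ⬝ᵥ u' = 1 → z ⬝ᵥ z = 1 → z' ⬝ᵥ z' = 1 → z ⬝ᵥ z' = 0 →
      u' ⬝ᵥ (M *ᵥ u') ≤ Ξ * (z ⬝ᵥ (M *ᵥ z) + z' ⬝ᵥ (M *ᵥ z')))
    (hB3 : ∀ u' v' z z' : Fin 3 → ℝ, u' ⬝ᵥ u' = 1 → v' ⬝ᵥ v' = 1 → z ⬝ᵥ z = 1 → z' ⬝ᵥ z' = 1 →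
      z ⬝ᵥ z' = 0 → u' ⬝ᵥ (N *ᵥ v') ≤ Ξ * (z ⬝ᵥ (M *ᵥ z) + z' ⬝ᵥ (M *ᵥ z')))
    {p : UU} (hp : p ∈ (unitSet ×ˢ unitSet : Set UU))
    (hpmin : IsMinOn (largestG Ψ ρ M) (unitSet ×ˢ unitSet) p) :
    0 ≤ largestG Ψ 0 (M * M + N * Nᵀ + (2 : ℝ) • M.sharp) p := by
  have hΨ0 : 0 < Ψ := by nlinarith
  have hmin := rayleigh_min_of_isMinOn_largestG hΨ0 hp hpmin
  have hmax := rayleigh_max_of_isMinOn_largestG hp hpmin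
  have h := largest_deriv_nonneg (N := N) hM hm hΞ hΨ h12 hA3 hB3 hp.1 hp.2 hmax hmin
  simpa [largestG] using h

section

variable (Ψ ρ : ℝ)

/-- The abstract step: the barrier lemma for `G_{Ψ,ρ}` along a matrix curve `M` with
field-shaped derivative. [cite: Hamilton1997, §2.1, Thm. 1.7 (proof, p. 11)] -/
theorem largest_preserved {M N M' : ℝ → Matrix (Fin 3) (Fin 3) ℝ} {t₀ t₁ m Ξ : ℝ}
    (h₁ : t₀ ≤ t₁) (hm : 0 < m) (hΞ : 0 < Ξ) (hΨ : 4 * Ξ ^ 2 + 1 ≤ Ψ)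
    (hMc : ContinuousOn M (Icc t₀ t₁)) (hM'c : ContinuousOn M' (Icc t₀ t₁))
    (hM'eq : ∀ s ∈ Icc t₀ t₁, M' s = M s * M s + N s * (N s)ᵀ + (2 : ℝ) • (M s).sharp)
    (hderiv : ∀ s ∈ Icc t₀ t₁, ∀ k l, _root_.HasDerivAt (fun t ↦ M t k l) (M' s k l) s)
    (hsymm : ∀ s ∈ Icc t₀ t₁, (M s).IsSymm)
    (h12 : ∀ s ∈ Icc t₀ t₁, (M s).TwoSmallestEigenvaluesSumGE m)
    (hA3 : ∀ s ∈ Ico t₀ t₁, ∀ u' z z' : Fin 3 → ℝ, u' ⬝ᵥ u' = 1 → z ⬝ᵥ z = 1 → z' ⬝ᵥ z' = 1 →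
      z ⬝ᵥ z' = 0 → u' ⬝ᵥ (M s *ᵥ u') ≤ Ξ * (z ⬝ᵥ (M s *ᵥ z) + z' ⬝ᵥ (M s *ᵥ z')))
    (hB3 : ∀ s ∈ Ico t₀ t₁, ∀ u' v' z z' : Fin 3 → ℝ, u' ⬝ᵥ u' = 1 → v' ⬝ᵥ v' = 1 → z ⬝ᵥ z = 1 →
      z' ⬝ᵥ z' = 1 → z ⬝ᵥ z' = 0 →
      u' ⬝ᵥ (N s *ᵥ v') ≤ Ξ * (z ⬝ᵥ (M s *ᵥ z) + z' ⬝ᵥ (M s *ᵥ z')))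
    (h0 : (M t₀).LargestLESmallestAdd Ψ ρ) : (M t₁).LargestLESmallestAdd Ψ ρ := by
  have hK : IsCompact (unitSet ×ˢ unitSet : Set UU) := isCompact_unitSet.prod isCompact_unitSet
  have hKne : (unitSet ×ˢ unitSet : Set UU).Nonempty := unitSet_nonempty.prod unitSet_nonempty
  have hGc := continuousOn_largestG Ψ ρ hMc (unitSet ×ˢ unitSet)
  have hG'c := continuousOn_largestG Ψ 0 hM'c (unitSet ×ˢ unitSet)
  have hGd : ∀ q ∈ (unitSet ×ˢ unitSet : Set UU), ∀ s ∈ Icc t₀ t₁,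
      _root_.HasDerivAt (fun t ↦ largestG Ψ ρ (M t) q) (largestG Ψ 0 (M' s) q) s :=
    fun q _ s hs ↦ hasDerivAt_largestG Ψ ρ (hderiv s hs) q
  have key := minOverSet_nonneg_of_deriv (G := fun t q ↦ largestG Ψ ρ (M t) q)
    (G' := fun t q ↦ largestG Ψ 0 (M' t) q) hK hKne hGc hGd hG'c h₁ one_pos le_rfl (η := 1)
    (C := 0) (fun s hs q hq hqmin _ _ ↦ ?_) ?_
  · rw [largestLESmallestAdd_iff]
    exact (le_minOverSet_iff hK hKne (continuousOn_slice (G := fun t q ↦ largestG Ψ ρ (M t) q)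
      hGc (right_mem_Icc.2 h₁)) 0).1 key
  · have hsI : s ∈ Icc t₀ t₁ := Ico_subset_Icc_self hs
    rw [zero_mul]
    have h := largest_sign Ψ ρ (N := N s) hm hΞ hΨ (hsymm s hsI) (h12 s hsI) (hA3 s hs) (hB3 s hs)
      hq hqmin
    simpa only [hM'eq s hsI] using h
  · refine (le_minOverSet_iff hK hKne (continuousOn_slice (G := fun t q ↦ largestG Ψ ρ (M t) q)
      hGc (left_mem_Icc.2 h₁)) 0).2 ?_
    exact (largestLESmallestAdd_iff Ψ ρ (M t₀)).1 h0

end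

/-- **Hamilton 1997, Thm. 1.7, ODE part, block `A` (proved).** [cite: Hamilton1997, §2.1, Thm. 1.7 (pp. 10–11)] -/
theorem isInvariantRel_largest_fst {m Ξ ρ Ψ : ℝ} (hm : 0 < m) (hΞ : 0 < Ξ) (hΨ : 4 * Ξ ^ 2 + 1 ≤ Ψ) :
    IsInvariantRel field
      (fun _ ↦ {p : Blocks | (p.1.IsSymm ∧ p.2.2.IsSymm) ∧ p.1.TwoSmallestEigenvaluesSumGE m ∧
        p.2.2.TwoSmallestEigenvaluesSumGE m ∧ MaxLEPairSum p Ξ ∧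
        p.1.SmallestEigenvalueAddNonneg ρ ∧ p.2.2.SmallestEigenvalueAddNonneg ρ})
      (fun _ ↦ {p | p.1.LargestLESmallestAdd Ψ ρ}) := by
  intro γ t₀ t₁ _ h₁ hγ hK hin
  have hγc := IsSolutionOn.continuousOn hγ
  refine largest_preserved Ψ ρ (M := fun s ↦ (γ s).1) (N := fun s ↦ (γ s).2.1)
    (M' := fun s ↦ (field (γ s)).1) h₁ hm hΞ hΨ (continuousOn_fst.comp hγc (mapsTo_univ _ _))
    (continuousOn_fst.comp (continuous_field.comp_continuousOn hγc) (mapsTo_univ _ _))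
    (fun s _ ↦ rfl) (fun s hs k l ↦ (hγ s hs).1 k l) (fun s hs ↦ (hK s hs).1.1)
    (fun s hs ↦ (hK s hs).2.1) (fun s hs u' z z' hu' hz hz' hzz' ↦ ?_)
    (fun s hs u' v' z z' hu' hv' hz hz' hzz' ↦ ?_) hin
  · obtain ⟨-, -, -, hX, -⟩ := hK s (Ico_subset_Icc_self hs)
    exact (hX u' u' z z' hu' hu' hz hz' hzz').1.1
  · obtain ⟨-, -, -, hX, -⟩ := hK s (Ico_subset_Icc_self hs)
    exact (hX u' v' z z' hu' hv' hz hz' hzz').1.2.1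

/-- **Hamilton 1997, Thm. 1.7, ODE part, block `C` (proved)** ("The other estimate is the same").
[cite: Hamilton1997, §2.1, Thm. 1.7 (pp. 10–11)] -/
theorem isInvariantRel_largest_snd {m Ξ ρ Ψ : ℝ} (hm : 0 < m) (hΞ : 0 < Ξ) (hΨ : 4 * Ξ ^ 2 + 1 ≤ Ψ) :
    IsInvariantRel field
      (fun _ ↦ {p : Blocks | (p.1.IsSymm ∧ p.2.2.IsSymm) ∧ p.1.TwoSmallestEigenvaluesSumGE m ∧
        p.2.2.TwoSmallestEigenvaluesSumGE m ∧ MaxLEPairSum p Ξ ∧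
        p.1.SmallestEigenvalueAddNonneg ρ ∧ p.2.2.SmallestEigenvalueAddNonneg ρ})
      (fun _ ↦ {p | p.2.2.LargestLESmallestAdd Ψ ρ}) := by
  intro γ t₀ t₁ _ h₁ hγ hK hin
  have hγc := IsSolutionOn.continuousOn hγ
  refine largest_preserved Ψ ρ (M := fun s ↦ (γ s).2.2) (N := fun s ↦ (γ s).2.1ᵀ)
    (M' := fun s ↦ (field (γ s)).2.2) h₁ hm hΞ hΨ
    ((continuousOn_snd.comp continuousOn_snd (mapsTo_univ _ _)).comp hγc (mapsTo_univ _ _))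
    ((continuousOn_snd.comp continuousOn_snd (mapsTo_univ _ _)).comp
      (continuous_field.comp_continuousOn hγc) (mapsTo_univ _ _))
    (fun s _ ↦ field_snd_snd (γ s)) (fun s hs k l ↦ (hγ s hs).2.2 k l) (fun s hs ↦ (hK s hs).1.2)
    (fun s hs ↦ (hK s hs).2.2.1) (fun s hs u' z z' hu' hz hz' hzz' ↦ ?_)
    (fun s hs u' v' z z' hu' hv' hz hz' hzz' ↦ ?_) hin
  · obtain ⟨-, -, -, hX, -⟩ := hK s (Ico_subset_Icc_self hs)
    exact (hX u' u' z z' hu' hu' hz hz' hzz').2.2.2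
  · obtain ⟨-, -, -, hX, -⟩ := hK s (Ico_subset_Icc_self hs)
    have h := (hX v' u' z z' hv' hu' hz hz' hzz').2.2.1
    simpa [Matrix.dotProduct_transpose_mulVec] using h

/-- **Hamilton 1997, Thm. 1.7, ODE part, both blocks (proved)** — exactly the Thm. 1.7 hypothesis
of `hamilton_chenZhu_pinching_of_ode₈` (`PinchingEstimatesReduction.lean`).
[cite: Hamilton1997, §2.1, Thm. 1.7 (pp. 10–11)] -/
theorem hamilton1997_B17_ode : ∀ m Ξ ρ Ψ : ℝ, 0 < m → 0 < Ξ → 4 * Ξ ^ 2 + 1 ≤ Ψ →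
    IsInvariantRel field
      (fun _ ↦ {p : Blocks | (p.1.IsSymm ∧ p.2.2.IsSymm) ∧ p.1.TwoSmallestEigenvaluesSumGE m ∧
        p.2.2.TwoSmallestEigenvaluesSumGE m ∧ MaxLEPairSum p Ξ ∧
        p.1.SmallestEigenvalueAddNonneg ρ ∧ p.2.2.SmallestEigenvalueAddNonneg ρ})
      (fun _ ↦ {p | p.1.LargestLESmallestAdd Ψ ρ ∧ p.2.2.LargestLESmallestAdd Ψ ρ}) :=
  fun _ _ _ _ hm hΞ hΨ ↦ (isInvariantRel_largest_fst hm hΞ hΨ).inter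
    (isInvariantRel_largest_snd hm hΞ hΨ)

end HamiltonODE

end Literature.Geometry.Riemannian

end
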